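import Summits.HodgeConjecture.CorCM.Census.OcticTwistScrewShapes

/-!
# The octic twist `(ℤ/8 × B, (4,0))`, XXVI: THE SCREW COLUMN (c) — the SCREW-ADAPTED covering family

COR-CM (cell `pub-hodgecm2`), count-neutral kernel combinatorics by the binder seat b09 (gen 35; lane COINVARIANT-TWIST / OCTIC RECON, the
screw column), on top of part XXV (`Census/OcticTwistScrewShapes.lean`: `Shaped`, `shaped_act`, `exists_orel'`), part XVII (`exists_orel`, `UCovers`,
`oriented_tw`, `balanced_tw_iff`, `exists_ucover_family`), parts III–IV and X–XI (`pot`, `Covers₂`, `spanMot`, `IsFace₂`, `potOrb`,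
`transl₂_rel`, `res_of_tw_eq`, `plc_snd_ne`) and the quartic files (`exists_orientedSquare`, `isUpper_atom`, `faceVec_cst_column`) BY NAME.
Theorems only; no definition, no certificate, no named fact, no `sorry`.
HONEST FRAMING: `HC_CM` is NOT proved, here or anywhere in the tree; nothing here is a period or a headline.

* **`exists_screw_family`** (`|B| ≥ 3`): given two SPECIAL faces — a mixed face `F₀ = (e_ψ − e_{ψ⁻}) ⊗ (e_{ψ′} − e_{ψ′⁻})` at a pair
  type `T₀ = (ψ, ψ′)` with BOTH coordinates balanced, and a coordinate-`1` cross square `F₁ = e_{ψ⁻} ⊗ (ψ′; p′, q′)` at `(ψ⁻, ψ′)` with `ψ⁻`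
  non-residual and unbalanced — there is a family `S ∋ F₀, F₁` of octic faces, at most one per block of potential `≥ 2`, whose motions
  cover (`Covers₂`), whose slices at the small residual passive coordinates satisfy `UCovers`, which contains the mixed squares, and whose
  reducing faces through every pair type with two UNBALANCED coordinates are `Shaped` (the blocks of `T₀` and of `(ψ⁻, ψ′)` contain no
  such type, no slice type and no `(±atom, ±atom)` type, so the generic choice of part XVII serves everywhere else).
All [folklore].

## References
* [Pohlmann1968] H. Pohlmann, Algebraic cycles on abelian varieties of complex multiplication type, Ann. of Math. 88 (1968), Thm 1.
-/

namespace Summit.HodgeConjecture.CorCM.Census.OcticTwist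

open Finset
open Summit.HodgeConjecture.CorCM.Census.QuarticTwist

variable (B : Type) [AddGroup B] [Fintype B] [DecidableEq B]

/-! ## The screw-adapted covering family -/

omit [Fintype B] [DecidableEq B] in
/-- The coordinates of a moved pair type are twists of the original coordinates (possibly exchanged). [folklore] -/
theorem act_mk_eq (e : Bool) (h : ZMod 4 × B) (x y : Ty B) :
    (e = false ∧ act B e h (x, y) = (tw B h x, tw B h y)) ∨ (e = true ∧ act B e h (x, y) = (tw B (h + (1, 0)) y, tw B h x)) := by
  cases e
  · exact Or.inl ⟨rfl, rfl⟩
  · refine Or.inr ⟨rfl, ?_⟩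
    rw [act_true]; show (tw B h (tw B (1, 0) y), tw B h x) = _; rw [tw_tw]

omit [DecidableEq B] in
/-- A pair type in the block of a doubly balanced pair type is doubly balanced. [folklore] -/
theorem balanced_of_act_eq {e : Bool} {h : ZMod 4 × B} {x y : Ty B} {T : Ty₂ B} (hT : act B e h (x, y) = T)
    (hx : ∀ w, IsMin B w x) (hy : ∀ w, IsMin B w y) : (∀ w, IsMin B w T.1) ∧ ∀ w, IsMin B w T.2 := by
  rcases act_mk_eq B e h x y with ⟨-, he⟩ | ⟨-, he⟩ <;> rw [← hT, he]
  · exact ⟨(balanced_tw_iff B h x).mpr hx, (balanced_tw_iff B h y).mpr hy⟩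
  · exact ⟨(balanced_tw_iff B _ y).mpr hy, (balanced_tw_iff B h x).mpr hx⟩

/-- A pair type in the block of `(x, y)` with `x` non-residual and `y` balanced has a balanced coordinate, the other one being
non-residual. [folklore] -/
theorem shape_of_act_eq {e : Bool} {h : ZMod 4 × B} {x y : Ty B} {T : Ty₂ B} (hT : act B e h (x, y) = T)
    (hx : ¬ IsRes B x) (hy : ∀ w, IsMin B w y) :
    (¬ IsRes B T.1 ∧ ∀ w, IsMin B w T.2) ∨ ((∀ w, IsMin B w T.1) ∧ ¬ IsRes B T.2) := by
  have hnr : ∀ g : ZMod 4 × B, ¬ IsRes B (tw B g x) := fun g hg => hx (by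
    have := isRes_tw B hg (-g); rwa [tw_neg_tw] at this)
  rcases act_mk_eq B e h x y with ⟨-, he⟩ | ⟨-, he⟩ <;> rw [← hT, he]
  · exact Or.inl ⟨hnr h, (balanced_tw_iff B h y).mpr hy⟩
  · exact Or.inr ⟨(balanced_tw_iff B _ y).mpr hy, hnr h⟩

omit [AddGroup B] in
/-- Residual types are not balanced (`|B| ≥ 3`). [folklore] -/
theorem not_balanced_of_isRes (h3 : 3 ≤ Fintype.card B) {s : Ty B} (hs : IsRes B s) : ¬ ∀ w, IsMin B w s := by
  obtain ⟨u, b, k, rfl⟩ := hs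
  intro hall
  exact (isUpper_atom B h3 u b k).2 (hall (u + 1))

/-- **THE SCREW-ADAPTED COVERING FAMILY** (`|B| ≥ 3`).  Let `T₀ = (ψ, ψ′)` be doubly balanced, `ψ⁻` non-residual and unbalanced, and let
`F₀ = (e_ψ − e_{ψ⁻}) ⊗ (e_{ψ′} − e_{ψ′⁻})`, `F₁ = e_{ψ⁻} ⊗ (ψ′; p′, q′)` be octic faces whose lower corners have smaller potential.  There is a
finite family `S ∋ F₀, F₁` of octic faces, at most one per block of potential `≥ 2`, with `Covers₂ (spanMot S)`, upper-end-oriented slices at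
every small residual passive coordinate, all mixed squares, and SHAPED reducing faces through every pair type of potential `≥ 2` with two
unbalanced coordinates. [folklore] -/
theorem exists_screw_family (h3 : 3 ≤ Fintype.card B) {ψ ψ' ψm ψ'm : Ty B} {p' q' : ZMod 2 × B}
    (hbal : ∀ w, IsMin B w ψ) (hbal' : ∀ w, IsMin B w ψ') (hψm : ¬ IsRes B ψm)
    (hF₀ : IsFace₂ B (tens B (Pi.single ψ 1 - Pi.single ψm 1) (Pi.single ψ' 1 - Pi.single ψ'm 1)))
    (hF₁ : IsFace₂ B (tens B (Pi.single ψm 1) (faceVec B ψ' p' q')))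
    (h01 : pot B (ψm, ψ') < pot B (ψ, ψ')) (h02 : pot B (ψ, ψ'm) < pot B (ψ, ψ')) (h03 : pot B (ψm, ψ'm) < pot B (ψ, ψ'))
    (h11 : Phi B (QuarticTwist.flip B p' ψ') < Phi B ψ') (h12 : Phi B (QuarticTwist.flip B q' ψ') < Phi B ψ')
    (h13 : Phi B (QuarticTwist.flip B q' (QuarticTwist.flip B p' ψ')) < Phi B ψ') (h2 : 2 ≤ pot B (ψm, ψ')) :
    ∃ S : Finset (Ty₂ B → ℤ), (∀ f ∈ S, IsFace₂ B f) ∧ S.card ≤ Fintype.card {ω : Orb₂ B // 2 ≤ potOrb B ω} ∧ Covers₂ B (spanMot B S) ∧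
      (∀ y : Ty B, IsRes B y → (¬ ∃ (u : ZMod 4) (b : B), y = atom B u b 2) → UCovers B ((spanMot B S).comap (emb₀ B y))) ∧
      (∀ (u : ZMod 4) (b : B) (k : ZMod 4) (u' : ZMod 4) (b' : B) (k' : ZMod 4), (k = 1 ∨ k = -1) → (k' = 1 ∨ k' = -1) →
        tens B (Pi.single (atom B u b k) 1 - Pi.single (cst B u) 1) (Pi.single (atom B u' b' k') 1 - Pi.single (cst B u') 1) ∈
          spanMot B S) ∧
      tens B (Pi.single ψ 1 - Pi.single ψm 1) (Pi.single ψ' 1 - Pi.single ψ'm 1) ∈ spanMot B S ∧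
      tens B (Pi.single ψm 1) (faceVec B ψ' p' q') ∈ spanMot B S ∧
      (∀ T : Ty₂ B, 2 ≤ pot B T → (¬ ∀ w, IsMin B w T.1) → (¬ ∀ w, IsMin B w T.2) → Shaped B (spanMot B S) T) := by
  classical
  haveI : Nonempty B := Fintype.card_pos_iff.mp (by omega)
  have h2₀ : 2 ≤ pot B (ψ, ψ') := by omega
  -- the two special blocks
  let ω₀ : {ω : Orb₂ B // 2 ≤ potOrb B ω} := ⟨Quotient.mk (orbitRel₂ B) (ψ, ψ'), by rw [potOrb_mk]; exact h2₀⟩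
  let ω₁ : {ω : Orb₂ B // 2 ≤ potOrb B ω} := ⟨Quotient.mk (orbitRel₂ B) (ψm, ψ'), by rw [potOrb_mk]; exact h2⟩
  have hne : ω₁ ≠ ω₀ := by
    intro h
    have h' : potOrb B ω₁.1 = potOrb B ω₀.1 := by rw [h]
    simp only [ω₀, ω₁, potOrb_mk] at h'
    omega
  -- membership in the special blocks
  have mem₀ : ∀ T : Ty₂ B, Quotient.mk (orbitRel₂ B) T = ω₀.1 → ∃ (e : Bool) (h : ZMod 4 × B), act B e h (ψ, ψ') = T :=
    fun T hT => Quotient.exact hT.symm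
  have mem₁ : ∀ T : Ty₂ B, Quotient.mk (orbitRel₂ B) T = ω₁.1 → ∃ (e : Bool) (h : ZMod 4 × B), act B e h (ψm, ψ') = T :=
    fun T hT => Quotient.exact hT.symm
  -- generic data
  have hrep : ∀ ω : {ω : Orb₂ B // 2 ≤ potOrb B ω}, 2 ≤ pot B ω.1.out := by
    intro ω
    have h := ω.2
    rw [← Quotient.out_eq ω.1, potOrb_mk] at h
    exact h
  choose T₁ T₂ T₃ hF hP hc1 hc3 hc5 hc6 using fun ω : {ω : Orb₂ B // 2 ≤ potOrb B ω} => exists_orel' B h3 ω.1.out (hrep ω)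
  let Fg : {ω : Orb₂ B // 2 ≤ potOrb B ω} → (Ty₂ B → ℤ) := fun ω =>
    Pi.single ω.1.out 1 - Pi.single (T₁ ω) 1 - Pi.single (T₂ ω) 1 + Pi.single (T₃ ω) 1
  let F₀ : Ty₂ B → ℤ := tens B (Pi.single ψ 1 - Pi.single ψm 1) (Pi.single ψ' 1 - Pi.single ψ'm 1)
  let F₁ : Ty₂ B → ℤ := tens B (Pi.single ψm 1) (faceVec B ψ' p' q')
  let F : {ω : Orb₂ B // 2 ≤ potOrb B ω} → (Ty₂ B → ℤ) := fun ω => if ω = ω₀ then F₀ else if ω = ω₁ then F₁ else Fg ω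
  let S := Finset.univ.image F
  have hFmem : ∀ ω, F ω ∈ S := fun ω => Finset.mem_image_of_mem F (Finset.mem_univ ω)
  have hmemS : ∀ ω, ∀ (e : Bool) (h : ZMod 4 × B), transl₂ B e h (F ω) ∈ spanMot B S :=
    fun ω e h => transl₂_mem_spanMot_of_mem B (hFmem ω) e h
  have hF0 : F ω₀ = F₀ := by
    show (if ω₀ = ω₀ then F₀ else if ω₀ = ω₁ then F₁ else Fg ω₀) = F₀
    rw [if_pos rfl]
  have hF1 : F ω₁ = F₁ := by
    show (if ω₁ = ω₀ then F₀ else if ω₁ = ω₁ then F₁ else Fg ω₁) = F₁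
    rw [if_neg hne, if_pos rfl]
  have hFg : ∀ ω, ω ≠ ω₀ → ω ≠ ω₁ → F ω = Fg ω := fun ω h0 h1 => by
    show (if ω = ω₀ then F₀ else if ω = ω₁ then F₁ else Fg ω) = Fg ω
    rw [if_neg h0, if_neg h1]
  have hmot : ∀ v ∈ spanMot B S, ∀ (e : Bool) (h : ZMod 4 × B), transl₂ B e h v ∈ spanMot B S :=
    fun v hv e h => transl₂_mem_spanMot B hv e h
  -- the block of a type, and the transporter from the representative
  have hblock : ∀ T : Ty₂ B, 2 ≤ pot B T → ∃ (ω : {ω : Orb₂ B // 2 ≤ potOrb B ω}) (e : Bool) (h : ZMod 4 × B),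
      Quotient.mk (orbitRel₂ B) T = ω.1 ∧ act B e h ω.1.out = T := by
    intro T hT
    let ω : {ω : Orb₂ B // 2 ≤ potOrb B ω} := ⟨Quotient.mk (orbitRel₂ B) T, by rw [potOrb_mk]; exact hT⟩
    have hrel : (orbitRel₂ B).r ω.1.out T := Quotient.exact (Quotient.out_eq _)
    obtain ⟨e, h, hmove⟩ := hrel
    exact ⟨ω, e, h, rfl, hmove⟩
  -- generic blocks: every block containing a type with two unbalanced coordinates, or with a residual coordinate
  have hgen : ∀ T : Ty₂ B, ∀ ω : {ω : Orb₂ B // 2 ≤ potOrb B ω}, Quotient.mk (orbitRel₂ B) T = ω.1 →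
      ((¬ ∀ w, IsMin B w T.1) ∧ ¬ ∀ w, IsMin B w T.2) ∨ IsRes B T.1 ∨ IsRes B T.2 → ω ≠ ω₀ ∧ ω ≠ ω₁ := by
    intro T ω hω hT
    constructor
    · intro h0
      rw [h0] at hω
      obtain ⟨e, h, hmove⟩ := mem₀ T hω
      obtain ⟨b1, b2⟩ := balanced_of_act_eq B hmove hbal hbal'
      rcases hT with ⟨h1, -⟩ | r1 | r2
      · exact h1 b1
      · exact not_balanced_of_isRes B h3 r1 b1
      · exact not_balanced_of_isRes B h3 r2 b2
    · intro h1
      rw [h1] at hω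
      obtain ⟨e, h, hmove⟩ := mem₁ T hω
      rcases shape_of_act_eq B hmove hψm hbal' with ⟨n1, b2⟩ | ⟨b1, n2⟩
      · rcases hT with ⟨-, h2⟩ | r1 | r2
        · exact h2 b2
        · exact n1 r1
        · exact not_balanced_of_isRes B h3 r2 b2
      · rcases hT with ⟨hh1, -⟩ | r1 | r2
        · exact hh1 b1
        · exact not_balanced_of_isRes B h3 r1 b1
        · exact n2 r2
  refine ⟨S, ?_, Finset.card_image_le.trans (by rw [Finset.card_univ]), ?_, fun s₀ hres h2a => ?_, ?_, ?_, ?_, ?_⟩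
  · -- faces
    intro f hf
    obtain ⟨ω, _, rfl⟩ := Finset.mem_image.mp hf
    by_cases h0 : ω = ω₀
    · rw [h0, hF0]; exact hF₀
    by_cases h1 : ω = ω₁
    · rw [h1, hF1]; exact hF₁
    rw [hFg ω h0 h1]; exact hF ω
  · -- Covers₂
    intro T hT
    obtain ⟨ω, e, h, hω, hmove⟩ := hblock T hT
    by_cases h0 : ω = ω₀
    · rw [h0] at hω
      obtain ⟨e, h, hmove⟩ := mem₀ T hω
      have hpot : pot B (ψ, ψ') = pot B T := by rw [← hmove, pot_act]
      refine ⟨act B e h (ψm, ψ'), act B e h (ψ, ψ'm), act B e h (ψm, ψ'm), ?_, ?_, ?_, ?_⟩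
      · have hmem := hmemS ω₀ e h
        rw [hF0] at hmem
        dsimp only [F₀] at hmem
        rw [tens_sub_sub, ← single_eq_tens, ← single_eq_tens, ← single_eq_tens, ← single_eq_tens, transl₂_rel, hmove] at hmem
        exact hmem
      · rw [pot_act, ← hpot]; exact h01
      · rw [pot_act, ← hpot]; exact h02
      · rw [pot_act, ← hpot]; exact h03
    by_cases h1 : ω = ω₁
    · rw [h1] at hω
      obtain ⟨e, h, hmove⟩ := mem₁ T hω
      have hpot : pot B (ψm, ψ') = pot B T := by rw [← hmove, pot_act]
      refine ⟨act B e h (ψm, QuarticTwist.flip B p' ψ'), act B e h (ψm, QuarticTwist.flip B q' ψ'),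
        act B e h (ψm, QuarticTwist.flip B q' (QuarticTwist.flip B p' ψ')), ?_, ?_, ?_, ?_⟩
      · have hmem := hmemS ω₁ e h
        rw [hF1] at hmem
        dsimp only [F₁] at hmem
        rw [cface₁_eq, transl₂_rel, hmove] at hmem
        exact hmem
      · rw [pot_act, ← hpot, pot_mk, pot_mk]; omega
      · rw [pot_act, ← hpot, pot_mk, pot_mk]; omega
      · rw [pot_act, ← hpot, pot_mk, pot_mk]; omega
    have hpot : pot B ω.1.out = pot B T := by rw [← hmove, pot_act]
    refine ⟨act B e h (T₁ ω), act B e h (T₂ ω), act B e h (T₃ ω), ?_, ?_, ?_, ?_⟩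
    · have hmem := hmemS ω e h
      rw [hFg ω h0 h1] at hmem
      dsimp only [Fg] at hmem
      rw [transl₂_rel, hmove] at hmem
      exact hmem
    · rw [pot_act, ← hpot]; exact (hP ω).1
    · rw [pot_act, ← hpot]; exact (hP ω).2.1
    · rw [pot_act, ← hpot]; exact (hP ω).2.2
  · -- UCovers for the slice `emb₀ s₀`
    intro s hs
    have hT : 2 ≤ pot B (s, s₀) := by rw [pot_mk]; have := two_le_Phi_of_not_isRes B h3 hs; omega
    obtain ⟨ω, e, h, hω, hmove⟩ := hblock _ hT
    obtain ⟨hn0, hn1⟩ := hgen (s, s₀) ω hω (Or.inr (Or.inr hres))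
    have hmemω : ∀ (e : Bool) (h : ZMod 4 × B), transl₂ B e h (Fg ω) ∈ spanMot B S := fun e h => by
      rw [← hFg ω hn0 hn1]; exact hmemS ω e h
    cases e
    · rw [act_false] at hmove
      have h1 : tw B h ω.1.out.1 = s := (Prod.ext_iff.mp hmove).1
      have h2 : tw B h ω.1.out.2 = s₀ := (Prod.ext_iff.mp hmove).2
      have hs' : ¬ IsRes B ω.1.out.1 := fun hres' => hs (h1 ▸ isRes_tw B hres' h)
      obtain ⟨u, p, q, hpq, hrel, hor, hp, hq, hpq'⟩ := hc1 ω hs'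
      have hot := oriented_tw B h hor hp hq hpq'
      refine ⟨u + h.1, plc B h p, plc B h q, plc_snd_ne B hpq, ?_, ?_, ?_, ?_, ?_⟩
      · show tens B (faceVec B s (plc B h p) (plc B h q)) (Pi.single s₀ 1) ∈ spanMot B S
        have hmem := hmemω false h
        dsimp only [Fg] at hmem
        rw [hrel, transl₂_false_cface₀, h1, h2] at hmem
        exact hmem
      · rw [← h1]; exact hot.1
      · rw [← h1]; exact hot.2.1
      · rw [← h1]; exact hot.2.2.1
      · rw [← h1]; exact hot.2.2.2
    · rw [act_true] at hmove
      have h1 : tw B h (tw B (1, 0) ω.1.out.2) = s := (Prod.ext_iff.mp hmove).1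
      have h2 : tw B h ω.1.out.1 = s₀ := (Prod.ext_iff.mp hmove).2
      obtain ⟨hres1, hn2⟩ := res_of_tw_eq B hres h2a h h2
      rw [tw_tw] at h1
      have ht' : ¬ IsRes B ω.1.out.2 := fun hres' => hs (h1 ▸ isRes_tw B hres' _)
      obtain ⟨u, p, q, hpq, hrel, hor, hp, hq, hpq'⟩ := hc3 ω hres1 hn2 ht'
      have hot := oriented_tw B (h + (1, 0)) hor hp hq hpq'
      refine ⟨u + (h + (1, 0)).1, plc B (h + (1, 0)) p, plc B (h + (1, 0)) q, plc_snd_ne B hpq, ?_, ?_, ?_, ?_, ?_⟩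
      · show tens B (faceVec B s (plc B (h + (1, 0)) p) (plc B (h + (1, 0)) q)) (Pi.single s₀ 1) ∈ spanMot B S
        have hmem := hmemω true h
        dsimp only [Fg] at hmem
        rw [hrel, transl₂_true_tens, transl_single, transl_faceVec, h1, h2] at hmem
        exact hmem
      · rw [← h1]; exact hot.1
      · rw [← h1]; exact hot.2.1
      · rw [← h1]; exact hot.2.2.1
      · rw [← h1]; exact hot.2.2.2
  · -- the mixed squares at the `(±atom, ±atom)` types
    intro u b k u' b' k' hk hk'
    have pm : ∀ {k : ZMod 4}, (k = 1 ∨ k = -1) → lee k = 1 := fun hk => (lee_eq_one_iff _).mpr hk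
    have hT : 2 ≤ pot B (atom B u b k, atom B u' b' k') := by
      rw [pot_mk, Phi_atom B h3, Phi_atom B h3, pm hk, pm hk']
    obtain ⟨ω, e, h, hω, hmove⟩ := hblock _ hT
    obtain ⟨hn0, hn1⟩ := hgen _ ω hω (Or.inr (Or.inl ⟨u, b, k, rfl⟩))
    have hmemω : ∀ (e : Bool) (h : ZMod 4 × B), transl₂ B e h (Fg ω) ∈ spanMot B S := fun e h => by
      rw [← hFg ω hn0 hn1]; exact hmemS ω e h
    cases e
    · rw [act_false] at hmove
      have h1 : tw B h ω.1.out.1 = atom B u b k := (Prod.ext_iff.mp hmove).1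
      have h2 : tw B h ω.1.out.2 = atom B u' b' k' := (Prod.ext_iff.mp hmove).2
      have ha : ω.1.out.1 = atom B (u - h.1) (b + h.2) k := by
        have := congrArg (tw B (-h)) h1
        rw [tw_neg_tw, tw_atom] at this
        rw [this, Prod.fst_neg, Prod.snd_neg, sub_neg_eq_add, ← sub_eq_add_neg]
      have ha' : ω.1.out.2 = atom B (u' - h.1) (b' + h.2) k' := by
        have := congrArg (tw B (-h)) h2
        rw [tw_neg_tw, tw_atom] at this
        rw [this, Prod.fst_neg, Prod.snd_neg, sub_neg_eq_add, ← sub_eq_add_neg]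
      have hrel := hc5 ω _ _ _ _ _ _ (Prod.ext ha ha') hk hk'
      have hmem := hmemω false h
      dsimp only [Fg] at hmem
      rw [hrel, transl₂_false_tens, transl_sub, transl_sub, transl_single, transl_single, transl_single, transl_single, tw_atom, tw_atom,
        tw_cst, tw_cst, sub_add_cancel, sub_add_cancel, add_sub_cancel_right, add_sub_cancel_right] at hmem
      exact hmem
    · rw [act_true] at hmove
      have h1 : tw B h (tw B (1, 0) ω.1.out.2) = atom B u b k := (Prod.ext_iff.mp hmove).1
      have h2 : tw B h ω.1.out.1 = atom B u' b' k' := (Prod.ext_iff.mp hmove).2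
      rw [tw_tw] at h1
      have ha : ω.1.out.1 = atom B (u' - h.1) (b' + h.2) k' := by
        have := congrArg (tw B (-h)) h2
        rw [tw_neg_tw, tw_atom] at this
        rw [this, Prod.fst_neg, Prod.snd_neg, sub_neg_eq_add, ← sub_eq_add_neg]
      have ha' : ω.1.out.2 = atom B (u - (h + (1, 0)).1) (b + (h + (1, 0)).2) k := by
        have := congrArg (tw B (-(h + (1, 0)))) h1
        rw [tw_neg_tw, tw_atom] at this
        rw [this, Prod.fst_neg, Prod.snd_neg, sub_neg_eq_add, ← sub_eq_add_neg]
      have hrel := hc5 ω _ _ _ _ _ _ (Prod.ext ha ha') hk' hk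
      have hmem := hmemω true h
      dsimp only [Fg] at hmem
      rw [hrel, transl₂_true_tens, transl_sub, transl_sub, transl_single, transl_single, transl_single, transl_single, tw_atom, tw_atom,
        tw_cst, tw_cst, sub_add_cancel, sub_add_cancel, add_sub_cancel_right, add_sub_cancel_right] at hmem
      exact hmem
  · -- `F₀ ∈ spanMot S`
    have h := mem_spanMot_of_mem B (hFmem ω₀)
    rw [hF0] at h
    exact h
  · -- `F₁ ∈ spanMot S`
    have h := mem_spanMot_of_mem B (hFmem ω₁)
    rw [hF1] at h
    exact h
  · -- shapes at the doubly unbalanced types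
    intro T hT hb1 hb2
    obtain ⟨ω, e, h, hω, hmove⟩ := hblock T hT
    obtain ⟨hn0, hn1⟩ := hgen T ω hω (Or.inl ⟨hb1, hb2⟩)
    have hrep' : Shaped B (spanMot B S) ω.1.out := by
      refine hc6 ω (spanMot B S) ?_
      have hm := mem_spanMot_of_mem B (hFmem ω)
      rw [hFg ω hn0 hn1] at hm
      exact hm
    rw [← hmove]
    exact shaped_act B hmot hrep' e h

end Summit.HodgeConjecture.CorCM.Census.OcticTwist
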